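import Mathlib
import HarnessLib
import HarnessLib.Audit
import Summits.PneNP.PneNP.Theses.SymmetryBudget
import Literature.Computability.Complexity.SymmetricCircuit
import Summits.PneNP.PneNP.Theorems.SymmetryBudgetWindowBarrierCoreReduction
import Summits.PneNP.PneNP.Theorems.WindowBarrier.Negative.BudgetZero
import Summits.PneNP.PneNP.Theorems.WindowBarrier.Negative.InvarianceAndBridge

/-!
# Line `structured-preconditioning-rank` — crux `SymmetryBudget.WindowBarrier` (stmt-PneNP-2145)

Crux (fixed, route `route-PneNP-SymmetryBudget`, rank 4): there is `L ∈ P` whose graph slices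
`x ↦ [encode ⟨m, Gr x⟩ ∈ L]` are `Bud(m,⌊log₂ m⌋)`-invariant and, for every polynomial `p`,
infinitely often have no `Bud(m,⌊log₂ m⌋)`-symmetric threshold circuit of size `≤ p(m)`.

Idea (crux idea card `structured-preconditioning-rank`, triage r1: pass ×2). The crux text names
candidate (α): "𝔽₂-systems whose unknowns live on PAIRS of free vertices"; the standing disproof
(Disproof.lean F8) sharpens it to pair-variable systems whose equations are read off the free graph
`H` (e.g. "the all-ones 2-cochain on the triangles of `H` is a coboundary"). This line is the
(α)-specialisation of the crux:

* the witness language is EXPLICIT and Babai–Luks-free — `L_M = {⟨m, G⟩ : rank_{𝔽₂} M(free part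
  of G) is even}` for a LOCAL pair-matrix functor `M` (rows indexed by (block, unordered triple of
  free vertices), columns by (block, unordered pair of free vertices), entry = a fixed table applied
  to the atomic type of the five vertices in `H`); membership in `P` is Gaussian elimination with the
  tree's `GaussRankFP.codeFP_lrank` (stub S1, provable now, replaces the XL literature debt
  `babaiLuks1983_canonicalForm` of the picked line);
* the open core is an explicit-function, square-symmetric, simply-exponential lower bound
  (stub S2: `H ↦ rank M(H) mod 2` has no `Sym(g)`-symmetric `tcBasis` circuit of size `2^{dg}`,
  every `d`, i.o.) — transported to the window by the LANDED relocation calculus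
  (`CoreReduction.exists_core_circuit`, p77230), so `S1 → S2 → WindowBarrier` is kernel-checked here;
* the idea's lever, STRUCTURED PRECONDITIONING, is the line's decision tool (stub S3): a
  `2^{dg}`-size square-symmetric circuit decides rank parity correctly on every instance that has a
  colouring-definable good diagonal scaling (Kaltofen–Saunders certificate `rank A = N − mult₀
  charpoly(A·D·Aᵀ·D')` at block points `D = w(χ u, χ v)`, `χ` an `O(1)`-colouring of the vertices;
  by Cauchy–Binet in characteristic 2 "good" is the field-free parity criterion used below: some
  colour-profile class of nonsingular maximal minors has ODD size). Consequences proved below from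
  S2+S3 (no `sorry` outside stubs): the KILL CRITERION `not_coreHard_of_eventually_good` (if for
  some `c` all large definable instances are good — in particular if `SP(c)` holds — the core S2 is
  false for that functor) and the WITNESS FILTER `frequently_exists_notGood` (S2-witnesses are
  parity-balanced for every `c`, infinitely often).

Composition: `windowBarrier_of_rankParity : S1 → S2 → (crux restated over SymmetricCircuit.lean)`
and `WindowBarrier_of : WindowBarrier` by definitional unfolding of the route's inline
`Sym/HasSym/Bud/Gr` (verbatim `Circuit.IsSymmetricUnder` / `HasSymCircuit tcBasis` /
`pointStabiliserBudget` / `SimpleGraph.fromRel`, as in the picked line).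

Stubs (registered by `ledger skeleton check`; statements self-contained over existing decls):
* `stub_rankParitySliceLanguage` — S1, the rank-parity window language of a local pair-matrix
  functor is in `P`, has `Bud`-invariant slices, and computes `rank M(H) mod 2` on planted inputs
  (provable now; FP plumbing + Gaussian elimination over 𝔽₂; L).
* `stub_rankParityCoreHard` — S2, the OPEN core (hardest): some local pair-matrix functor has
  core-hard rank parity at every exponential rate.
* `stub_spCollapse` — S3, structured preconditioning is sound AND symmetric-cheap: instances with a
  good colouring-definable scaling are decided by `2^{dg}`-size square-symmetric circuits
  (provable now modulo formalising Dawar–Wilsenach ToC 2025 §4–5: symmetric Le Verrier over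
  `ℤ[w]`, reduced mod 2; L–XL). Not a hypothesis of `WindowBarrier_of`: it is the line's falsifier
  and witness filter, made formal.

Disproof.lean obligations honoured: F3 (invariance load-bearing) — S1 carries invariance for ALL
`m`; F3'/`windowBarrier_false_at_budget_zero` (symmetry load-bearing) — enters only through S2
(`IsSymmetricUnder Set.univ`, size `2^{dg}` ≥ the `P/poly` size of the slice, so S2 is not the
budget-0 statement); F7/F8 — the line IS F8's pair-variable candidate in core form (F7 rescaling =
`CoreReduction`); T0–T3 / materialised monadic tests (MonadicLayout p77105) — apply verbatim to any
S2 witness functor (an S2-hard `M` must in particular defeat subset-section materialisation: rank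
parity must not be a function of boundedly many subset statistics). No `_false_without_` theorem or
`Negative/*` lemma refutes S1–S3 (both Negative files imported here and checked against).
-/

-- `Summit.PneNP.PneNP.…` duplicates `PneNP` BY DESIGN (single-problem summit, D-0017).
set_option linter.dupNamespace false

namespace Summit.PneNP.PneNP.Cruxes.WindowBarrier.StructuredPreconditioningRank

open Literature.Computability.Complexity Filter
open scoped Classical

/-! ## Vocabulary (all INLINE in the statements; recorded here once for the reader)

* LOCAL pair-matrix functor with `b` blocks:
  `M : (g : ℕ) → SimpleGraph (Fin g) → Matrix (Fin b × Sym (Fin g) 3) (Fin b × Sym (Fin g) 2) (ZMod 2)`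
  — rows indexed by (block, unordered triple-multiset of vertices), columns by (block, unordered
  pair-multiset of vertices) — is LOCAL iff for some table
  `f : Fin b → Fin b → (Fin 5 → Fin 5 → Bool) → (Fin 5 → Fin 5 → Bool) → ZMod 2` and all `v : Fin 5 → Fin g`,
  `M g H (i, {v 0, v 1, v 2}) (j, {v 3, v 4}) = f i j (adjacency pattern of v in H) (equality pattern of v)`
  (so `f` is, in effect, a function of the isomorphism type of `(H; row-set, column-set)`; locality makes
  `M g (σ • H)` the reindexing of `M g H` by `Sym.map σ`, hence rank parity is isomorphism-invariant —
  no F3-type vacuity). UNORDERED indices are essential: duplicated columns cancel in characteristic 2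
  (`A D Aᵀ = Σ_q d_q A_q A_qᵀ`), so with ordered pairs every orientation-duplicate would have to be
  separated by the colouring and the certificate below would fail for a trivial reason.
  Examples: the simplicial coboundary `δ₁ : C¹ → C²` of the clique (flag) complex of `H` (row `{a,b,c}`,
  column `{u,v}`: `1` iff `abc` is a triangle of `H` and `{u,v} ⊂ {a,b,c}`, `u ≠ v`), its augmentation
  `[δ₁ | 1_T]` (diagonal pairs `{u,u}` as copies of the all-ones-on-triangles column), incidence and
  path matrices, and block systems coupling several of these (`b ≥ 2`). Rank `≤ b·C(g+1,2)`.
  Rank parity of `δ₁` is `|E| − g + #components − dim H¹(Flag H; 𝔽₂)` mod 2, so S2 for `δ₁` is the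
  symmetric hardness of `dim H¹(Flag H; 𝔽₂) mod 2`; `[δ₁ | 1_T]` vs `δ₁` is Disproof F8's
  "is the all-ones 2-cochain a coboundary" (edge unknowns — not guessable by subset gates, unlike
  vertex unknowns / 1-coboundaries).
* Planted input of `H` at `m = n + g` (verbatim `CoreReduction.exists_plant`): adjacency of `H` on the
  free block `{n,…,n+g-1}²`, `false` elsewhere.
* `Good c A` for `A = M g H` (structured-preconditioning certificate, field-free form): there are a
  colouring `χ : Fin g → Fin c` and colour profiles `π` (a multiset over (block, pair of colours)) and
  `π'` (over (block, triple of colours)) such that the number of pairs `(I, J)` of `r`-subsets of rows /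
  columns, `r = rank A`, with `A[I,J]` nonsingular, `profile I = π'`, `profile J = π` is ODD.
  Equivalently (Cauchy–Binet in characteristic 2 + Schwartz–Zippel): for some block-diagonal scalings
  `D = diag w(block, Sym.map χ ·)` on columns and `D'` on rows with values in some `GF(2^k)`,
  `N − mult₀ charpoly(A D Aᵀ D') = rank A` (Kaltofen–Saunders certificate at a colouring-definable point).
  `SP(c)` := every `A` is `Good c`; PARITY-BALANCED for `c` := not `Good c`.
-/

/-! ## The stubs -/

/-- **S1 — the rank-parity window language of a local pair-matrix functor (provable now; L).**
For every number of blocks `b` and every LOCAL functor `M` there is a language `L ∈ P` such that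
(i) every `m`-slice `x ↦ [encode ⟨m, Gr x⟩ ∈ L]` is `Bud(m,⌊log₂ m⌋)`-invariant (for ALL `m`), and
(ii) whenever `⌊log₂ (n+g)⌋ = g`, on every planted input `x` of a graph `H` on `Fin g` (adjacency of `H`
on the free block, `false` elsewhere) membership in `L` is exactly `[rank_{𝔽₂} (M g H) is even]`.
Intended witness: `⟨m, G⟩ ∈ L` iff the `𝔽₂`-rank of `M ⌊log₂ m⌋` applied to the subgraph of `G` induced
on the last `⌊log₂ m⌋` vertices (relabelled `j ↦ m - ⌊log₂ m⌋ + j`) is even. (i): `ρ ∈ Bud` permutes the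
free block by some `σ ∈ Sym(Fin g)` (`CoreBridge.exists_restrict`) and fixes the rest; `Gr (x ∘ ρ×ρ)`
induces `σ • H`; locality makes `M g (σ • H)` the reindexing of `M g H` by `Sym.map σ` on both index
sorts (`Matrix.rank_reindex`). (ii): `Gr x` restricted to the free block IS `H` (planted matrices are
symmetric with `false` diagonal; `SimpleGraph.fromRel` symmetrises and drops loops).
Membership in `P`: decode and extract the free part (the landed extraction bricks of the picked line:
`SymmetryBudgetWindowBarrier{RankDict,ExtractBricks,ExtractBricks2,GraphBridge}.lean`), list the
`b·C(g+2,3)` rows of length `b·C(g+1,2)` by evaluating the finite table `f` (constant work per entry),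
and take the rank over `𝔽₂` with the tree's polynomial-time Gaussian elimination on codes
`GaussRankFP.codeFP_lrank` (`GaussRank.rank_eq_finrank_span` identifies it with `Matrix.rank`); parity
and the final `CodeFP → FP → Classes.P` packaging are routine (`FPStringBricks`, `preimage_mem_P`).
Why it might fail: only by a slip in encoding conventions (it is Babai–Luks-free by design). Size L
(≈ 600–1200 lines, all infrastructure in tree). Sources: this line; Arora–Barak 2009 §1.3;
von zur Gathen–Gerhard 2013 §12.1 (as cited in `GaussRankFP.lean`). -/
theorem stub_rankParitySliceLanguage :
    ∀ (b : ℕ) (M : (g : ℕ) → SimpleGraph (Fin g) →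
        Matrix (Fin b × Sym (Fin g) 3) (Fin b × Sym (Fin g) 2) (ZMod 2)),
      (∃ f : Fin b → Fin b → (Fin 5 → Fin 5 → Bool) → (Fin 5 → Fin 5 → Bool) → ZMod 2,
        ∀ (g : ℕ) (H : SimpleGraph (Fin g)) (i j : Fin b) (v : Fin 5 → Fin g),
          M g H (i, (v 0 ::ₛ v 1 ::ₛ v 2 ::ₛ Sym.nil)) (j, (v 3 ::ₛ v 4 ::ₛ Sym.nil)) =
            f i j (fun k l => decide (H.Adj (v k) (v l))) (fun k l => decide (v k = v l))) →
      ∃ L ∈ Classes.P,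
        (∀ m : ℕ, ∀ ρ ∈ pointStabiliserBudget m (Nat.log 2 m), ∀ x : Fin m × Fin m → Bool,
          encodingGraph.encode ⟨m, SimpleGraph.fromRel fun u v => x (ρ u, ρ v) = true⟩ ∈ L ↔
            encodingGraph.encode ⟨m, SimpleGraph.fromRel fun u v => x (u, v) = true⟩ ∈ L) ∧
        (∀ (n g : ℕ), Nat.log 2 (n + g) = g →
          ∀ (H : SimpleGraph (Fin g)) (x : Fin (n + g) × Fin (n + g) → Bool),
            (∀ q : Fin (n + g) × Fin (n + g), ¬ (n ≤ (q.1 : ℕ) ∧ n ≤ (q.2 : ℕ)) → x q = false) →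
            (∀ q : Fin (n + g) × Fin (n + g), ∀ h : n ≤ (q.1 : ℕ) ∧ n ≤ (q.2 : ℕ),
              x q = decide (H.Adj ⟨q.1 - n, by omega⟩ ⟨q.2 - n, by omega⟩)) →
            (encodingGraph.encode ⟨n + g, SimpleGraph.fromRel fun u v => x (u, v) = true⟩ ∈ L ↔
              Even (M g H).rank)) := by
  sorry

/-- **S2 — rank parity of some local pair-matrix functor is core-hard at every exponential rate
(the OPEN core; hardest stub; the explicit-function (α)-form of (★) CoreFooling).**
There are `b` and a LOCAL functor `M` such that for every `d`, for infinitely many `g`, NO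
`Sym(Fin g)`-symmetric (square-symmetric) `tcBasis`-circuit with at most `2^{d g}` gates computes
`H ↦ [rank_{𝔽₂} (M g H) is even]` on all simple graphs `H` on `Fin g`. Relations: weaker than a rank-
separated fooling pair per rate (any circuit-independent pair proof gives that stronger form), neither
implies nor follows from (★) formally, and implies the crux through S1 (this file). Status: a first
rung is KNOWN TECHNOLOGY — rank parity of a suitable `M` is not `C^{o(g/log g)}`-invariant (pair-variable
`𝔽₂` systems interpret Tseitin/3-XOR: CFI-type twins; doi:10.1016/j.tcs.2008.12.049, doi:10.1109/LICS.2009.24),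
which with Dawar–Wilsenach ToC 2025 Thm 6.4 (tree named fact `DawarWilsenach2025_orbitSize_countingWidth`)
gives the statement for every size bound `2^{o(g)}`; it is NECESSARY too (a `C^k`-invariant property has
symmetric circuits of size `g^{O(k)}` via `k`-WL). OPEN at `2^{dg}` exactly like (★): gate orbits in
`(2^g, g!)` void the support theorem. Candidate functors: `δ₁` of the flag complex (⟺ `dim H¹(Flag H; 𝔽₂)
mod 2`), `[δ₁ | 1_T]` (Disproof F8), block couplings; instance families: flag complexes that are
2-dimensional coboundary/cosystolic expanders (edge-variable XOR on LSV complexes is SoS-hard while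
vertex-variable XOR on HDX is easy — arXiv:2009.05218 vs Alev–Jeronimo–Tulsiani FOCS 2019 — the same
vertex/edge dichotomy as the window's subset-guessing power). Design constraints PROVED in this file
(modulo S3): an `M` witnessing S2 has, for every `c`, infinitely many PARITY-BALANCED instances
(`frequently_exists_notGood`); by the landed materialisation theorems (MonadicLayout p77105, S4-filters)
its rank parity is moreover not a function of boundedly many subset-section statistics.
Why it might fail: `SP(c)` on the local functors for some constant `c` (then S3 decides the rank parity
of EVERY local functor at rate `⌈log₂ c⌉+1`: line dead, candidate (α) dead — `not_coreHard_of_eventually_good`);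
or TAME (a `2^{O(g)}` symmetric canoniser, Disproof F12), which kills the crux itself. Size: unknown (new
mathematics). Sources: Disproof.lean F8; doi:10.4086/toc.2025.v021a014 §6; doi:10.1016/j.tcs.2008.12.049;
doi:10.1109/LICS.2009.24; arXiv:2009.05218; Kaltofen–Saunders 1991 (LNCS 539, 29–38). -/
theorem stub_rankParityCoreHard :
    ∃ (b : ℕ) (M : (g : ℕ) → SimpleGraph (Fin g) →
        Matrix (Fin b × Sym (Fin g) 3) (Fin b × Sym (Fin g) 2) (ZMod 2)),
      (∃ f : Fin b → Fin b → (Fin 5 → Fin 5 → Bool) → (Fin 5 → Fin 5 → Bool) → ZMod 2,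
        ∀ (g : ℕ) (H : SimpleGraph (Fin g)) (i j : Fin b) (v : Fin 5 → Fin g),
          M g H (i, (v 0 ::ₛ v 1 ::ₛ v 2 ::ₛ Sym.nil)) (j, (v 3 ::ₛ v 4 ::ₛ Sym.nil)) =
            f i j (fun k l => decide (H.Adj (v k) (v l))) (fun k l => decide (v k = v l))) ∧
      ∀ d : ℕ, ∃ᶠ g in atTop, ¬ ∃ D : Circuit (Fin g × Fin g),
        D.IsOver tcBasis ∧ D.size ≤ 2 ^ (d * g) ∧ D.IsSymmetricUnder Set.univ ∧
        ∀ H : SimpleGraph (Fin g),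
          D.eval (fun p : Fin g × Fin g => decide (H.Adj p.1 p.2)) = decide (Even (M g H).rank) := by
  sorry

/-- **S3 — structured preconditioning is sound and symmetric-cheap (the idea's lever; provable now
modulo formalisation; L–XL).** For every number of colours `c`, every `b` and every LOCAL functor `M`
there are `d, g₀` such that for all `g ≥ g₀` some `Sym(Fin g)`-symmetric `tcBasis`-circuit with at most
`2^{d g}` gates outputs `[rank_{𝔽₂} (M g H) is even]` on every `H` whose matrix `A = M g H` is GOOD for
`c` colours (some colour-profile class of pairs `(I, J)` of `r`-subsets, `r = rank A`, with `A[I,J]`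
nonsingular has ODD size, for some `χ : Fin g → Fin c`). The circuit (every gate orbit `≤ c^g · 2^{o(g)}`,
so `d = ⌈log₂ c⌉ + 1` works): for each of the `c^g` colourings `χ` (one block of gates per `χ`, permuted by
`Sym(g)` — a `c`-colouring guess, the `c`-ary version of the landed nested subset guesses
`exists_symCircuit_subsetsOp`), compute the characteristic polynomial of the INTEGER lift
`B_χ = Ã·D_w·Ãᵀ·D_{w'}` over `ℤ[w, w']` (one variable per (block, colour multiset): `≤ b(c²+c³)` variables,
`≤ (2r+1)^{b(c²+c³)} = 2^{o(g)}` monomials, poly-bit coefficients) by Le Verrier / Csanky — matrix powers,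
traces and Newton identities are index-uniform, hence symmetric (Dawar–Wilsenach ToC 2025 §4, symmetric
circuits for the determinant/char-poly over characteristic 0; §5, arithmetic→threshold translation;
Dawar–Grohe–Holm–Laubner LICS 2009: linear algebra over ℚ in FPC) — reduce the coefficients mod 2
(char-poly commutes with ring maps), let `K_χ := max {k : e_k(B_χ) ≢ 0 mod 2 as a polynomial in w, w'}`,
and output the parity of `max_χ K_χ` (OR/threshold over the `χ`-blocks, then rank comparison gadgets).
Soundness: at every evaluation `N − mult₀ charpoly(B) ≤ rank B ≤ rank A` (algebraic ≥ geometric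
multiplicity of the eigenvalue `0`; `Matrix.rank_mul_le_left`), so `e_k ≡ 0` for `k > r` and `K_χ ≤ r`;
and `e_r(A D Aᵀ D') = Σ_{(I,J) nonsingular} d^J d'^I` (Cauchy–Binet twice; `det² = det` for `𝔽₂`
values), whose block substitution has coefficient (class size mod 2) at the monomial `w^π w'^{π'}` — so
`K_χ = r` for some `χ` iff `A` is good (`MvPolynomial.schwartz_zippel_totalDegree` turns `≢ 0` into an
actual good scaling over `GF(2^k)`, `2^k > 2r`, if the evaluated form is wanted). Hence the output is the
rank parity on every good instance (and the parity of a strict under-estimate on balanced ones).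
Why it might fail: only formalisation debt (no symmetric arithmetic / char-poly circuits in the tree
yet). Sources: doi:10.4086/toc.2025.v021a014 §4–5; doi:10.1109/LICS.2009.24; Kaltofen–Saunders,
AAECC-9 (LNCS 539) 1991, 29–38; Chen–Eberly–Kaltofen–Saunders–Turner–Villard, LAA 343–344 (2002) 119–146;
TRIAGE-r1-2 / TRIAGE-r1-3 (independent algebra checks of the certificate and the parity criterion). -/
theorem stub_spCollapse :
    ∀ (c b : ℕ) (M : (g : ℕ) → SimpleGraph (Fin g) →
        Matrix (Fin b × Sym (Fin g) 3) (Fin b × Sym (Fin g) 2) (ZMod 2)),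
      (∃ f : Fin b → Fin b → (Fin 5 → Fin 5 → Bool) → (Fin 5 → Fin 5 → Bool) → ZMod 2,
        ∀ (g : ℕ) (H : SimpleGraph (Fin g)) (i j : Fin b) (v : Fin 5 → Fin g),
          M g H (i, (v 0 ::ₛ v 1 ::ₛ v 2 ::ₛ Sym.nil)) (j, (v 3 ::ₛ v 4 ::ₛ Sym.nil)) =
            f i j (fun k l => decide (H.Adj (v k) (v l))) (fun k l => decide (v k = v l))) →
      ∃ d g₀ : ℕ, ∀ g : ℕ, g₀ ≤ g → ∃ D : Circuit (Fin g × Fin g),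
        D.IsOver tcBasis ∧ D.size ≤ 2 ^ (d * g) ∧ D.IsSymmetricUnder Set.univ ∧
        ∀ H : SimpleGraph (Fin g),
          (∃ (χ : Fin g → Fin c) (π : Multiset (Fin b × Sym (Fin c) 2))
              (π' : Multiset (Fin b × Sym (Fin c) 3)),
            Odd (Finset.card (Finset.filter
              (fun IJ : Finset (Fin b × Sym (Fin g) 3) × Finset (Fin b × Sym (Fin g) 2) =>
                ((M g H).submatrix (fun i : IJ.1 => (i : Fin b × Sym (Fin g) 3))
                    (fun j : IJ.2 => (j : Fin b × Sym (Fin g) 2))).rank = (M g H).rank ∧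
                IJ.1.val.map (fun r => (r.1, Sym.map χ r.2)) = π' ∧
                IJ.2.val.map (fun q => (q.1, Sym.map χ q.2)) = π)
              (Finset.univ.powersetCard (M g H).rank ×ˢ Finset.univ.powersetCard (M g H).rank)))) →
          D.eval (fun p : Fin g × Fin g => decide (H.Adj p.1 p.2)) = decide (Even (M g H).rank) := by
  sorry

/-! ## Composition (no `sorry` below this line) -/

/-- **`S1 → S2 → WindowBarrier`**, with the crux written over the landed vocabulary
(`HasSymCircuit tcBasis`, `pointStabiliserBudget`) — definitionally the route's inline `HasSym`/`Bud`.
Proof: take `b, M` from S2 and `L` from S1. Given `p`, choose `d, g₀` with `p(2^g) + 2 ≤ 2^{dg}` for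
`g ≥ g₀` (`CoreReduction.exists_pow_bound`); S2 at `d` gives, frequently in `g`, sizes with no core
circuit; at `m = 2^g = n + g` a `Bud`-symmetric circuit of size `≤ p m` for the slice would, by the
landed circuit transfer `CoreReduction.exists_core_circuit` (hard-wire the non-free inputs to `0`),
give a square-symmetric circuit of size `≤ p m + 2 ≤ 2^{dg}` taking on the adjacency matrix of every
`H` the value of the slice on the planted input of `H`, which by S1 (ii) is `[rank (M g H) even]` —
a core circuit, contradiction. -/
theorem windowBarrier_of_rankParity
    (h₁ : ∀ (b : ℕ) (M : (g : ℕ) → SimpleGraph (Fin g) →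
        Matrix (Fin b × Sym (Fin g) 3) (Fin b × Sym (Fin g) 2) (ZMod 2)),
      (∃ f : Fin b → Fin b → (Fin 5 → Fin 5 → Bool) → (Fin 5 → Fin 5 → Bool) → ZMod 2,
        ∀ (g : ℕ) (H : SimpleGraph (Fin g)) (i j : Fin b) (v : Fin 5 → Fin g),
          M g H (i, (v 0 ::ₛ v 1 ::ₛ v 2 ::ₛ Sym.nil)) (j, (v 3 ::ₛ v 4 ::ₛ Sym.nil)) =
            f i j (fun k l => decide (H.Adj (v k) (v l))) (fun k l => decide (v k = v l))) →
      ∃ L ∈ Classes.P,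
        (∀ m : ℕ, ∀ ρ ∈ pointStabiliserBudget m (Nat.log 2 m), ∀ x : Fin m × Fin m → Bool,
          encodingGraph.encode ⟨m, SimpleGraph.fromRel fun u v => x (ρ u, ρ v) = true⟩ ∈ L ↔
            encodingGraph.encode ⟨m, SimpleGraph.fromRel fun u v => x (u, v) = true⟩ ∈ L) ∧
        (∀ (n g : ℕ), Nat.log 2 (n + g) = g →
          ∀ (H : SimpleGraph (Fin g)) (x : Fin (n + g) × Fin (n + g) → Bool),
            (∀ q : Fin (n + g) × Fin (n + g), ¬ (n ≤ (q.1 : ℕ) ∧ n ≤ (q.2 : ℕ)) → x q = false) →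
            (∀ q : Fin (n + g) × Fin (n + g), ∀ h : n ≤ (q.1 : ℕ) ∧ n ≤ (q.2 : ℕ),
              x q = decide (H.Adj ⟨q.1 - n, by omega⟩ ⟨q.2 - n, by omega⟩)) →
            (encodingGraph.encode ⟨n + g, SimpleGraph.fromRel fun u v => x (u, v) = true⟩ ∈ L ↔
              Even (M g H).rank)))
    (h₂ : ∃ (b : ℕ) (M : (g : ℕ) → SimpleGraph (Fin g) →
        Matrix (Fin b × Sym (Fin g) 3) (Fin b × Sym (Fin g) 2) (ZMod 2)),
      (∃ f : Fin b → Fin b → (Fin 5 → Fin 5 → Bool) → (Fin 5 → Fin 5 → Bool) → ZMod 2,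
        ∀ (g : ℕ) (H : SimpleGraph (Fin g)) (i j : Fin b) (v : Fin 5 → Fin g),
          M g H (i, (v 0 ::ₛ v 1 ::ₛ v 2 ::ₛ Sym.nil)) (j, (v 3 ::ₛ v 4 ::ₛ Sym.nil)) =
            f i j (fun k l => decide (H.Adj (v k) (v l))) (fun k l => decide (v k = v l))) ∧
      ∀ d : ℕ, ∃ᶠ g in atTop, ¬ ∃ D : Circuit (Fin g × Fin g),
        D.IsOver tcBasis ∧ D.size ≤ 2 ^ (d * g) ∧ D.IsSymmetricUnder Set.univ ∧
        ∀ H : SimpleGraph (Fin g),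
          D.eval (fun p : Fin g × Fin g => decide (H.Adj p.1 p.2)) = decide (Even (M g H).rank)) :
    ∃ L ∈ Classes.P,
      (∀ m : ℕ, ∀ ρ ∈ pointStabiliserBudget m (Nat.log 2 m), ∀ x : Fin m × Fin m → Bool,
        encodingGraph.encode ⟨m, SimpleGraph.fromRel fun u v => x (ρ u, ρ v) = true⟩ ∈ L ↔
          encodingGraph.encode ⟨m, SimpleGraph.fromRel fun u v => x (u, v) = true⟩ ∈ L) ∧
      ∀ p : Polynomial ℕ, ∃ᶠ m in atTop,
        ¬ HasSymCircuit tcBasis (pointStabiliserBudget m (Nat.log 2 m)) (p.eval m)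
            (fun x : Fin m × Fin m → Bool =>
              decide (encodingGraph.encode ⟨m, SimpleGraph.fromRel fun u v => x (u, v) = true⟩ ∈ L)) := by
  obtain ⟨b, M, hloc, hhard⟩ := h₂
  obtain ⟨L, hLP, hinv, hval⟩ := h₁ b M hloc
  refine ⟨L, hLP, hinv, fun p => ?_⟩
  obtain ⟨d, g₀, hd⟩ := Summit.PneNP.PneNP.Theorems.CoreReduction.exists_pow_bound p
  rw [Filter.frequently_atTop]
  intro a
  obtain ⟨g, hga, hno⟩ := (Filter.frequently_atTop.1 (hhard d)) (max a g₀)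
  have hg₀ : g₀ ≤ g := le_of_max_le_right hga
  have hag : a ≤ g := le_of_max_le_left hga
  -- `m = 2^g = n + g`
  have hgle : g ≤ 2 ^ g := (Nat.lt_two_pow_self).le
  set n : ℕ := 2 ^ g - g with hn
  have hm : n + g = 2 ^ g := by omega
  have hlog : Nat.log 2 (n + g) = g := by rw [hm, Nat.log_pow (by norm_num)]
  refine ⟨n + g, by omega, ?_⟩
  rintro ⟨C, hB, hsize, hsym, hcomp⟩
  rw [hlog] at hsym
  obtain ⟨D, hDB, hDs, hDsym, hDev⟩ :=
    Summit.PneNP.PneNP.Theorems.CoreReduction.exists_core_circuit n g C hB hsym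
  apply hno
  refine ⟨D, hDB, ?_, hDsym, fun H => ?_⟩
  · rw [hDs]
    have := hd g hg₀
    rw [← hm] at this
    omega
  · obtain ⟨x, -, hx0, hx1⟩ := Summit.PneNP.PneNP.Theorems.CoreReduction.exists_plant n H
    rw [hDev H x hx0 hx1, hcomp x]
    exact decide_eq_decide.mpr (hval n g hlog H x hx0 hx1)

/-- **Skeleton theorem**: the crux `SymmetryBudget.WindowBarrier`, concluded BY NAME from S1 and S2.
The route decl is a `let Sym … HasSym … Bud … Gr …` prelude followed by the statement; those lets are
verbatim `Circuit.IsSymmetricUnder`, `HasSymCircuit tcBasis`, `pointStabiliserBudget` and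
`SimpleGraph.fromRel fun u v => x (u, v) = true`, so `windowBarrier_of_rankParity` closes it by
definitional unfolding. -/
theorem WindowBarrier_of : Summit.PneNP.PneNP.Theses.SymmetryBudget.WindowBarrier := by
  have H := windowBarrier_of_rankParity stub_rankParitySliceLanguage stub_rankParityCoreHard
  exact H

/-! ## The dichotomy made formal (consequences of S2-type hardness and S3; no `sorry`) -/

/-- **Kill criterion (structured preconditioning kills the (α)-line).** If for some number of colours
`c` EVERY instance `M g H` with `g` large is good (in particular if `SP(c)` holds for all matrices of this
shape over `𝔽₂`), then by S3 the rank parity of `M` is core-CHEAP at rate `d(c)`: the S2-type hardness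
statement fails for this functor. [this line] -/
theorem not_coreHard_of_eventually_good
    (h₃ : ∀ (c b : ℕ) (M : (g : ℕ) → SimpleGraph (Fin g) →
        Matrix (Fin b × Sym (Fin g) 3) (Fin b × Sym (Fin g) 2) (ZMod 2)),
      (∃ f : Fin b → Fin b → (Fin 5 → Fin 5 → Bool) → (Fin 5 → Fin 5 → Bool) → ZMod 2,
        ∀ (g : ℕ) (H : SimpleGraph (Fin g)) (i j : Fin b) (v : Fin 5 → Fin g),
          M g H (i, (v 0 ::ₛ v 1 ::ₛ v 2 ::ₛ Sym.nil)) (j, (v 3 ::ₛ v 4 ::ₛ Sym.nil)) =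
            f i j (fun k l => decide (H.Adj (v k) (v l))) (fun k l => decide (v k = v l))) →
      ∃ d g₀ : ℕ, ∀ g : ℕ, g₀ ≤ g → ∃ D : Circuit (Fin g × Fin g),
        D.IsOver tcBasis ∧ D.size ≤ 2 ^ (d * g) ∧ D.IsSymmetricUnder Set.univ ∧
        ∀ H : SimpleGraph (Fin g),
          (∃ (χ : Fin g → Fin c) (π : Multiset (Fin b × Sym (Fin c) 2))
              (π' : Multiset (Fin b × Sym (Fin c) 3)),
            Odd (Finset.card (Finset.filter
              (fun IJ : Finset (Fin b × Sym (Fin g) 3) × Finset (Fin b × Sym (Fin g) 2) =>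
                ((M g H).submatrix (fun i : IJ.1 => (i : Fin b × Sym (Fin g) 3))
                    (fun j : IJ.2 => (j : Fin b × Sym (Fin g) 2))).rank = (M g H).rank ∧
                IJ.1.val.map (fun r => (r.1, Sym.map χ r.2)) = π' ∧
                IJ.2.val.map (fun q => (q.1, Sym.map χ q.2)) = π)
              (Finset.univ.powersetCard (M g H).rank ×ˢ Finset.univ.powersetCard (M g H).rank)))) →
          D.eval (fun p : Fin g × Fin g => decide (H.Adj p.1 p.2)) = decide (Even (M g H).rank))
    (c b : ℕ) (M : (g : ℕ) → SimpleGraph (Fin g) →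
        Matrix (Fin b × Sym (Fin g) 3) (Fin b × Sym (Fin g) 2) (ZMod 2))
    (hloc :
      (∃ f : Fin b → Fin b → (Fin 5 → Fin 5 → Bool) → (Fin 5 → Fin 5 → Bool) → ZMod 2,
        ∀ (g : ℕ) (H : SimpleGraph (Fin g)) (i j : Fin b) (v : Fin 5 → Fin g),
          M g H (i, (v 0 ::ₛ v 1 ::ₛ v 2 ::ₛ Sym.nil)) (j, (v 3 ::ₛ v 4 ::ₛ Sym.nil)) =
            f i j (fun k l => decide (H.Adj (v k) (v l))) (fun k l => decide (v k = v l))))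
    (hgood : ∀ᶠ g in atTop, ∀ H : SimpleGraph (Fin g),
          (∃ (χ : Fin g → Fin c) (π : Multiset (Fin b × Sym (Fin c) 2))
              (π' : Multiset (Fin b × Sym (Fin c) 3)),
            Odd (Finset.card (Finset.filter
              (fun IJ : Finset (Fin b × Sym (Fin g) 3) × Finset (Fin b × Sym (Fin g) 2) =>
                ((M g H).submatrix (fun i : IJ.1 => (i : Fin b × Sym (Fin g) 3))
                    (fun j : IJ.2 => (j : Fin b × Sym (Fin g) 2))).rank = (M g H).rank ∧
                IJ.1.val.map (fun r => (r.1, Sym.map χ r.2)) = π' ∧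
                IJ.2.val.map (fun q => (q.1, Sym.map χ q.2)) = π)
              (Finset.univ.powersetCard (M g H).rank ×ˢ Finset.univ.powersetCard (M g H).rank))))) :
    ¬ ∀ d : ℕ, ∃ᶠ g in atTop, ¬ ∃ D : Circuit (Fin g × Fin g),
        D.IsOver tcBasis ∧ D.size ≤ 2 ^ (d * g) ∧ D.IsSymmetricUnder Set.univ ∧
        ∀ H : SimpleGraph (Fin g),
          D.eval (fun p : Fin g × Fin g => decide (H.Adj p.1 p.2)) = decide (Even (M g H).rank) := by
  intro hhard
  obtain ⟨d, g₀, hD⟩ := h₃ c b M hloc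
  have hev : ∀ᶠ g in atTop, ∃ D : Circuit (Fin g × Fin g),
      D.IsOver tcBasis ∧ D.size ≤ 2 ^ (d * g) ∧ D.IsSymmetricUnder Set.univ ∧
      ∀ H : SimpleGraph (Fin g),
        D.eval (fun p : Fin g × Fin g => decide (H.Adj p.1 p.2)) = decide (Even (M g H).rank) := by
    filter_upwards [hgood, eventually_ge_atTop g₀] with g hg hgg
    obtain ⟨D, hDB, hDs, hDsym, hDev⟩ := hD g hgg
    exact ⟨D, hDB, hDs, hDsym, fun H => hDev H (hg H)⟩
  exact (hhard d).and_eventually hev |>.exists.elim fun g hg => hg.1 hg.2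

/-- **Witness filter (the idea's Transfer, necessity direction).** If the rank parity of a local
functor `M` is core-hard at every rate (S2-type hypothesis for this `M`) then, granted S3, for EVERY
number of colours `c` there are infinitely many `g` with a PARITY-BALANCED instance `M g H`: under every
`c`-colouring every colour-profile class of nonsingular maximal minors has even size. This is the
concrete design target for S2 (kit-searchable at `g ≤ 8`; the Sym(g)-invariant / Johnson-scheme family is
where balance occurs first, TRIAGE-r1-3). [this line] -/
theorem frequently_exists_notGood
    (h₃ : ∀ (c b : ℕ) (M : (g : ℕ) → SimpleGraph (Fin g) →
        Matrix (Fin b × Sym (Fin g) 3) (Fin b × Sym (Fin g) 2) (ZMod 2)),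
      (∃ f : Fin b → Fin b → (Fin 5 → Fin 5 → Bool) → (Fin 5 → Fin 5 → Bool) → ZMod 2,
        ∀ (g : ℕ) (H : SimpleGraph (Fin g)) (i j : Fin b) (v : Fin 5 → Fin g),
          M g H (i, (v 0 ::ₛ v 1 ::ₛ v 2 ::ₛ Sym.nil)) (j, (v 3 ::ₛ v 4 ::ₛ Sym.nil)) =
            f i j (fun k l => decide (H.Adj (v k) (v l))) (fun k l => decide (v k = v l))) →
      ∃ d g₀ : ℕ, ∀ g : ℕ, g₀ ≤ g → ∃ D : Circuit (Fin g × Fin g),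
        D.IsOver tcBasis ∧ D.size ≤ 2 ^ (d * g) ∧ D.IsSymmetricUnder Set.univ ∧
        ∀ H : SimpleGraph (Fin g),
          (∃ (χ : Fin g → Fin c) (π : Multiset (Fin b × Sym (Fin c) 2))
              (π' : Multiset (Fin b × Sym (Fin c) 3)),
            Odd (Finset.card (Finset.filter
              (fun IJ : Finset (Fin b × Sym (Fin g) 3) × Finset (Fin b × Sym (Fin g) 2) =>
                ((M g H).submatrix (fun i : IJ.1 => (i : Fin b × Sym (Fin g) 3))
                    (fun j : IJ.2 => (j : Fin b × Sym (Fin g) 2))).rank = (M g H).rank ∧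
                IJ.1.val.map (fun r => (r.1, Sym.map χ r.2)) = π' ∧
                IJ.2.val.map (fun q => (q.1, Sym.map χ q.2)) = π)
              (Finset.univ.powersetCard (M g H).rank ×ˢ Finset.univ.powersetCard (M g H).rank)))) →
          D.eval (fun p : Fin g × Fin g => decide (H.Adj p.1 p.2)) = decide (Even (M g H).rank))
    (b : ℕ) (M : (g : ℕ) → SimpleGraph (Fin g) →
        Matrix (Fin b × Sym (Fin g) 3) (Fin b × Sym (Fin g) 2) (ZMod 2))
    (hloc :
      (∃ f : Fin b → Fin b → (Fin 5 → Fin 5 → Bool) → (Fin 5 → Fin 5 → Bool) → ZMod 2,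
        ∀ (g : ℕ) (H : SimpleGraph (Fin g)) (i j : Fin b) (v : Fin 5 → Fin g),
          M g H (i, (v 0 ::ₛ v 1 ::ₛ v 2 ::ₛ Sym.nil)) (j, (v 3 ::ₛ v 4 ::ₛ Sym.nil)) =
            f i j (fun k l => decide (H.Adj (v k) (v l))) (fun k l => decide (v k = v l))))
    (hhard : ∀ d : ℕ, ∃ᶠ g in atTop, ¬ ∃ D : Circuit (Fin g × Fin g),
        D.IsOver tcBasis ∧ D.size ≤ 2 ^ (d * g) ∧ D.IsSymmetricUnder Set.univ ∧
        ∀ H : SimpleGraph (Fin g),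
          D.eval (fun p : Fin g × Fin g => decide (H.Adj p.1 p.2)) = decide (Even (M g H).rank))
    (c : ℕ) :
    ∃ᶠ g in atTop, ∃ H : SimpleGraph (Fin g),
      ¬ (∃ (χ : Fin g → Fin c) (π : Multiset (Fin b × Sym (Fin c) 2))
            (π' : Multiset (Fin b × Sym (Fin c) 3)),
          Odd (Finset.card (Finset.filter
            (fun IJ : Finset (Fin b × Sym (Fin g) 3) × Finset (Fin b × Sym (Fin g) 2) =>
              ((M g H).submatrix (fun i : IJ.1 => (i : Fin b × Sym (Fin g) 3))
                  (fun j : IJ.2 => (j : Fin b × Sym (Fin g) 2))).rank = (M g H).rank ∧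
              IJ.1.val.map (fun r => (r.1, Sym.map χ r.2)) = π' ∧
              IJ.2.val.map (fun q => (q.1, Sym.map χ q.2)) = π)
            (Finset.univ.powersetCard (M g H).rank ×ˢ Finset.univ.powersetCard (M g H).rank)))) := by
  by_contra hcon
  rw [Filter.not_frequently] at hcon
  have hgood := hcon.mono fun g hg => (fun H => not_not.mp (not_exists.mp hg H))
  exact not_coreHard_of_eventually_good h₃ c b M hloc hgood hhard

/-- The witness filter instantiated with the line's stubs: the functor of S2 has parity-balanced
instances for every number of colours, infinitely often (modulo S2, S3). [this line] -/
theorem rankParityCoreHard_witness_isBalanced :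
    ∃ (b : ℕ) (M : (g : ℕ) → SimpleGraph (Fin g) →
        Matrix (Fin b × Sym (Fin g) 3) (Fin b × Sym (Fin g) 2) (ZMod 2)),
      ∀ c : ℕ, ∃ᶠ g in atTop, ∃ H : SimpleGraph (Fin g),
        ¬ (∃ (χ : Fin g → Fin c) (π : Multiset (Fin b × Sym (Fin c) 2))
              (π' : Multiset (Fin b × Sym (Fin c) 3)),
            Odd (Finset.card (Finset.filter
              (fun IJ : Finset (Fin b × Sym (Fin g) 3) × Finset (Fin b × Sym (Fin g) 2) =>
                ((M g H).submatrix (fun i : IJ.1 => (i : Fin b × Sym (Fin g) 3))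
                    (fun j : IJ.2 => (j : Fin b × Sym (Fin g) 2))).rank = (M g H).rank ∧
                IJ.1.val.map (fun r => (r.1, Sym.map χ r.2)) = π' ∧
                IJ.2.val.map (fun q => (q.1, Sym.map χ q.2)) = π)
              (Finset.univ.powersetCard (M g H).rank ×ˢ Finset.univ.powersetCard (M g H).rank)))) := by
  obtain ⟨b, M, hloc, hhard⟩ := stub_rankParityCoreHard
  exact ⟨b, M, fun c => frequently_exists_notGood stub_spCollapse b M hloc hhard c⟩

end Summit.PneNP.PneNP.Cruxes.WindowBarrier.StructuredPreconditioningRank
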